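import Summits.BirchSwinnertonDyer.BirchSwinnertonDyer.Theorems.ManinLocalTwoThreeShimuraClassesGenusOne
import Summits.BirchSwinnertonDyer.Rank1Residual.ManinAdditive.ShimuraIndexFrickeLaw
import HarnessLib

/-!
# C2 `ManinOddAtFour` helper (es g45, T-es-104) — EXACT ORDERS OF THE `2`-PRIMARY SHIMURA CLASSES:
# `¬ ShimuraIndexPrimeTo 2 f` for every non-zero `f ∈ S₂(Γ₀(N))`, `N ∈ {17, 20, 24, 32}`, FACT-FREE

HONEST FRAMING. Printed mathematics (Mazur 1977 §II.11; Ling–Oesterlé 1991, Thm. 1: `#Σ(17) = 4`, `#Σ(20) = #Σ(24) = #Σ(32) = 2`;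
Stevens 1989 §2), new formal proofs on top of T-es-102 (`…Theorems.ManinLocalTwoThreeShimuraClasses` §1–§2, p782338, and `…ShimuraClassesGenusOne` §3–§5, p782399: the covering classes
`exists_shimuraHom_*` and the non-memberships `n·{∞, γ∞}_f ∉ Λ₁(f)`). Beyond-print theorem: NO. Nothing about the Manin constant of
any curve is asserted; C2, C3, Manin's conjecture and BSD stay OPEN. No `sorry`, no new axiom, no instance/notation.

WHAT. T-es-102 bounds the order of the class of `x = {∞, γ∞}_f` in `Λ(f)/Λ₁(f)` from BELOW (`n·x ∉ Λ₁(f)` unless `2 ∣ n`, resp.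
`4 ∣ n` at `17`). Here the matching UPPER relations are supplied by Manin's three kinds of relations, so that the order is EXACT and
the route predicate `KatoCurve.ShimuraIndexPrimeTo 2` is REFUTED at these levels for every `f ≠ 0`:
* §1 `N = 20` (`γ₇ = (3 1; 20 7)`): powers give only `4x ∈ Λ₁` (`7² ≡ 9`, `7⁴ ≡ 1`); the PARABOLIC `P = (−9 5; −20 11) = k(1 5; 0 1)k⁻¹`,
  `k = (1 0; 2 1)`, fixes the cusp `1/2`, so `{∞, P∞} = 0` (landed `periodFunctional_eq_zero_of_conj_upper`), and `d_P = 11 ≡ −9 =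
  −d_{γ₇²}` gives **`2x ∈ Λ₁(f)`**; with T-es-102: **`n·x ∈ Λ₁(f) ↔ 2 ∣ n`**, **`¬ ShimuraIndexPrimeTo 2 f`**.
* §2 `N = 24` (`γ₅ = (5 1; 24 5)`): `5² ≡ 1 (mod 24)` — powers suffice: `2x ∈ Λ₁(f)`; order exactly `2`; `¬ ShimuraIndexPrimeTo 2 f`.
* §3 `N = 32` (`γ = (13 2; 32 5)`): powers give only `8x ∈ Λ₁` (`5` has order `8` mod `32`); the PARABOLIC `P = (−23 3; −192 25) =
  k(1 3; 0 1)k⁻¹`, `k = (1 0; 8 1)` (cusp `1/8`), has `d_P = 25 = d_{γ²}`: **`2x ∈ Λ₁(f)`**; order exactly `2`; `¬ ShimuraIndexPrimeTo 2 f`.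
* §4 `N = 17` (`γ₃ = (6 1; 17 3)`): powers give only `8x ∈ Λ₁` (`3⁸ ≡ −1`); the ELLIPTIC `ε = (4 −1; 17 −4)` of order `4` (`εk = kS`,
  `k = (1 0; 4 1)`, fixing `i/(4i+1)`) has `{∞, ε∞} = 0` (landed `periodFunctional_eq_zero_of_conj_S`) and `d_ε = −4 ≡ 13 ≡ 3⁴ = d_{γ₃⁴}`:
  **`4x ∈ Λ₁(f)`**; with T-es-102: **`n·x ∈ Λ₁(f) ↔ 4 ∣ n`** (order EXACTLY `4` = `#Σ(17)`), and **`¬ ShimuraIndexPrimeTo 2 f`**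
  (witness `2x`).
C2 READING (negative data, fact-free): at the additive genus-one levels `20`, `24`, `32` of C2's domain `4 ∣ N` the Shimura quotient
`Λ(f)/Λ₁(f)` has EVEN order with an explicit class of order exactly `2`, for every `f ≠ 0`; no C2 closer may assume
`ShimuraIndexPrimeTo 2 D.f` there (E15-LATTICE-INDEX-v1 rows `20a1`, `24a1`, `32a1`: index `2`; `17a1`: index `4` ✓).

References: [Mazur1977] §II.11; [LingOesterle1991] Thm. 1; [Stevens1989] §2; [Manin1972] §1.5–1.7.
-/

set_option autoImplicit false

noncomputable section

-- justification: the `Summit.BirchSwinnertonDyer.BirchSwinnertonDyer.…` path repeats a component (route-file convention)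
set_option linter.dupNamespace false

open scoped Classical MatrixGroups

open CongruenceSubgroup Matrix.SpecialLinearGroup ModularGroup
open Literature.NumberTheory.EllipticCurves.ModularForms
open Summit.BirchSwinnertonDyer.BirchSwinnertonDyer.Theorems.ThetaLayerLambdaCongruenceAtTwo
open Summit.BirchSwinnertonDyer.BirchSwinnertonDyer.Theorems.ManinLocalTwoThree.ShimuraClass
open Summit.BirchSwinnertonDyer.Rank1Residual.ManinAdditive.KatoCurve (ShimuraIndexPrimeTo)

namespace Summit.BirchSwinnertonDyer.BirchSwinnertonDyer.Theorems.ManinLocalTwoThree.ShimuraTwo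

/-! ## §1. Level `20`: the class of `{∞, γ₇∞}_f` has order exactly `2` -/

section Twenty

/-- `n·{∞, γ₇∞}_f ∉ Λ₁(f)` for odd `n` (T-es-102's class `(5 | ·)`). [cite: LingOesterle1991, Thm. 1] -/
theorem zsmul_cuspSymbol_gammaSeven_not_mem_twenty (f : CuspForm (Gamma0 20) 2) (hf : f ≠ 0) (n : ℤ)
    (hn : (n : ZMod 2) ≠ 0) : (n : ℂ) * cuspSymbol f gammaSeven ∉ periodLatticeGamma1 f := by
  obtain ⟨φ, hφ⟩ := exists_shimuraHom_twenty
  refine zsmul_cuspSymbol_not_mem_of_hom φ _ hφ (fun γ₁ ↦ char_apply_gamma1 (by norm_num) charFive (by decide) γ₁) f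
    ((finrank_eq_one_iff_of_nonzero' f hf).mp finrank_cuspForm_two_eq_genusX0_twenty.2.1) gammaSeven n ?_
  rw [show (((gammaSeven : SL(2, ℤ)) 1 1 : ℤ)) = 7 from rfl, zsmul_eq_mul]
  rw [show charFive ((7 : ℤ) : ZMod 5) = 1 from by decide, mul_one]
  exact hn

/-- The parabolic `P = (−9 5; −20 11) = k (1 5; 0 1) k⁻¹ ∈ Γ₀(20)`, `k = (1 0; 2 1)`, fixing the cusp `1/2`; `d_P = 11`. [folklore] -/
def parabolicHalf : Gamma0 20 :=
  ⟨⟨!![-9, 5; -20, 11], by rw [Matrix.det_fin_two_of]; norm_num⟩, by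
    rw [Gamma0_mem]
    show (((-20 : ℤ) : ZMod 20)) = 0
    decide⟩

/-- `k = (1 0; 2 1)`. [folklore] -/
def kHalf : SL(2, ℤ) := ⟨!![1, 0; 2, 1], by rw [Matrix.det_fin_two_of]; norm_num⟩

/-- `k⁻¹ = (1 0; −2 1)`. [folklore] -/
def kHalfInv : SL(2, ℤ) := ⟨!![1, 0; -2, 1], by rw [Matrix.det_fin_two_of]; norm_num⟩

/-- `k · k⁻¹ = 1`. [folklore] -/
theorem kHalf_mul_inv : kHalf * kHalfInv = 1 := by
  apply Subtype.ext
  rw [Matrix.SpecialLinearGroup.coe_mul, Matrix.SpecialLinearGroup.coe_one]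
  ext i j
  fin_cases i <;> fin_cases j <;> rfl

/-- `{∞, P∞} = 0` in `S₂(Γ₀(20))^∨` (cusp stabiliser). [cite: Manin1972, §1.5] -/
theorem periodFunctional_parabolicHalf : periodFunctional 20 parabolicHalf = 0 := by
  refine periodFunctional_eq_zero_of_conj_upper parabolicHalf kHalf ?_
  rw [inv_eq_of_mul_eq_one_right kHalf_mul_inv]
  rfl

/-- **`2·{∞, γ₇∞}_f ∈ Λ₁(f)`** at level `20`: `d_{γ₇²} ≡ 9 ≡ −d_P` and `{∞, P∞} = 0`. [cite: LingOesterle1991, §1] -/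
theorem two_mul_cuspSymbol_gammaSeven_mem_twenty (f : CuspForm (Gamma0 20) 2) :
    (2 : ℂ) * cuspSymbol f gammaSeven ∈ periodLatticeGamma1 f := by
  have hpow : cuspSymbol f (gammaSeven ^ 2) = (2 : ℂ) * cuspSymbol f gammaSeven := by
    rw [cuspSymbol_pow_eq_natCast_mul f gammaSeven 2]; push_cast; ring
  have hP : cuspSymbol f parabolicHalf = 0 := by
    rw [← periodFunctional_apply, periodFunctional_parabolicHalf, LinearMap.zero_apply]
  have hd : ((((gammaSeven ^ 2 : Gamma0 20) : SL(2, ℤ)) 1 1 : ℤ) : ZMod 20) =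
      -((((parabolicHalf : SL(2, ℤ)) 1 1 : ℤ) : ZMod 20)) := by
    rw [apply_one_one_pow_eq, show (((gammaSeven : SL(2, ℤ)) 1 1 : ℤ)) = 7 from rfl,
      show (((parabolicHalf : SL(2, ℤ)) 1 1 : ℤ)) = 11 from rfl]
    decide
  have := cuspSymbol_sub_mem_periodLatticeGamma1_of_apply_eq_neg f parabolicHalf (gammaSeven ^ 2) hd
  rwa [hP, sub_zero, hpow] at this

/-- **THE CLASS OF `{∞, γ₇∞}_f` IN `Λ(f)/Λ₁(f)` HAS ORDER EXACTLY `2`** at level `20` (`f ≠ 0`; E15 row `20a1`: index `2`).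
[cite: LingOesterle1991, Thm. 1] -/
theorem zsmul_cuspSymbol_gammaSeven_mem_iff_twenty (f : CuspForm (Gamma0 20) 2) (hf : f ≠ 0) (n : ℤ) :
    (n : ℂ) * cuspSymbol f gammaSeven ∈ periodLatticeGamma1 f ↔ (2 : ℤ) ∣ n := by
  constructor
  · intro h
    by_contra hnd
    exact zsmul_cuspSymbol_gammaSeven_not_mem_twenty f hf n
      (fun h0 ↦ hnd ((ZMod.intCast_zmod_eq_zero_iff_dvd n 2).mp h0)) h
  · rintro ⟨m, rfl⟩
    rw [Int.cast_mul, show ((2 : ℤ) : ℂ) = 2 by norm_num, mul_comm (2 : ℂ) (m : ℂ), mul_assoc, ← zsmul_eq_mul]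
    exact (periodLatticeGamma1 f).zsmul_mem (two_mul_cuspSymbol_gammaSeven_mem_twenty f) m

/-- **`¬ ShimuraIndexPrimeTo 2 f` AT THE ADDITIVE LEVEL `20`** for every non-zero `f ∈ S₂(Γ₀(20))` (witness `{∞, γ₇∞}_f`).
[cite: LingOesterle1991, Thm. 1] -/
theorem not_shimuraIndexPrimeTo_two_twenty (f : CuspForm (Gamma0 20) 2) (hf : f ≠ 0) :
    ¬ ShimuraIndexPrimeTo 2 f := fun h ↦
  cuspSymbol_gammaSeven_not_mem_twenty f hf
    (h _ (cuspSymbol_mem_periodLattice f gammaSeven) (by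
      rw [show ((2 : ℕ) : ℂ) = 2 by norm_num]
      exact two_mul_cuspSymbol_gammaSeven_mem_twenty f))

end Twenty

/-! ## §2. Level `24`: `5² ≡ 1 (mod 24)` — the class of `{∞, γ₅∞}_f` has order exactly `2` -/

section TwentyFour

/-- `n·{∞, γ₅∞}_f ∉ Λ₁(f)` for odd `n` at level `24` (class `(12 | ·)`). [cite: LingOesterle1991, Thm. 1] -/
theorem zsmul_cuspSymbol_gammaFive_not_mem_twentyFour (f : CuspForm (Gamma0 24) 2) (hf : f ≠ 0) (n : ℤ)
    (hn : (n : ZMod 2) ≠ 0) : (n : ℂ) * cuspSymbol f gammaFiveLevel24 ∉ periodLatticeGamma1 f := by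
  obtain ⟨φ, hφ⟩ := exists_shimuraHom_twentyFour
  refine zsmul_cuspSymbol_not_mem_of_hom φ _ hφ (fun γ₁ ↦ char_apply_gamma1 (by norm_num) charTwelve (by decide) γ₁) f
    ((finrank_eq_one_iff_of_nonzero' f hf).mp finrank_cuspForm_two_twentyFour) gammaFiveLevel24 n ?_
  rw [show (((gammaFiveLevel24 : SL(2, ℤ)) 1 1 : ℤ)) = 5 from rfl, zsmul_eq_mul]
  rw [show charTwelve ((5 : ℤ) : ZMod 12) = 1 from by decide, mul_one]
  exact hn

/-- **`2·{∞, γ₅∞}_f ∈ Λ₁(f)`** at level `24`: `d_{γ₅}² = 25 ≡ 1`, so `γ₅² ∈ Γ₁(24)`. [cite: Stevens1989, §2] -/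
theorem two_mul_cuspSymbol_gammaFive_mem_twentyFour (f : CuspForm (Gamma0 24) 2) :
    (2 : ℂ) * cuspSymbol f gammaFiveLevel24 ∈ periodLatticeGamma1 f := by
  have := natCast_mul_cuspSymbol_mem_periodLatticeGamma1_of_pow_apply f gammaFiveLevel24 2
    (Or.inl (by rw [show (((gammaFiveLevel24 : SL(2, ℤ)) 1 1 : ℤ)) = 5 from rfl]; decide))
  exact_mod_cast this

/-- **Order exactly `2`** at level `24`: `n·{∞, γ₅∞}_f ∈ Λ₁(f) ↔ 2 ∣ n` (`f ≠ 0`; E15 row `24a1`: index `2`).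
[cite: LingOesterle1991, Thm. 1] -/
theorem zsmul_cuspSymbol_gammaFive_mem_iff_twentyFour (f : CuspForm (Gamma0 24) 2) (hf : f ≠ 0) (n : ℤ) :
    (n : ℂ) * cuspSymbol f gammaFiveLevel24 ∈ periodLatticeGamma1 f ↔ (2 : ℤ) ∣ n := by
  constructor
  · intro h
    by_contra hnd
    exact zsmul_cuspSymbol_gammaFive_not_mem_twentyFour f hf n
      (fun h0 ↦ hnd ((ZMod.intCast_zmod_eq_zero_iff_dvd n 2).mp h0)) h
  · rintro ⟨m, rfl⟩
    rw [Int.cast_mul, show ((2 : ℤ) : ℂ) = 2 by norm_num, mul_comm (2 : ℂ) (m : ℂ), mul_assoc, ← zsmul_eq_mul]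
    exact (periodLatticeGamma1 f).zsmul_mem (two_mul_cuspSymbol_gammaFive_mem_twentyFour f) m

/-- **`¬ ShimuraIndexPrimeTo 2 f` AT THE ADDITIVE LEVEL `24`** for every non-zero `f ∈ S₂(Γ₀(24))`. [cite: LingOesterle1991, Thm. 1] -/
theorem not_shimuraIndexPrimeTo_two_twentyFour (f : CuspForm (Gamma0 24) 2) (hf : f ≠ 0) :
    ¬ ShimuraIndexPrimeTo 2 f := fun h ↦
  (periodLattice_ne_periodLatticeGamma1_twentyFour f hf).1
    (h _ (cuspSymbol_mem_periodLattice f gammaFiveLevel24) (by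
      rw [show ((2 : ℕ) : ℂ) = 2 by norm_num]
      exact two_mul_cuspSymbol_gammaFive_mem_twentyFour f))

end TwentyFour

/-! ## §3. Level `32`: the parabolic at `1/8` — the class of `{∞, γ∞}_f` has order exactly `2` -/

section ThirtyTwo

/-- `n·{∞, γ∞}_f ∉ Λ₁(f)` for odd `n` at level `32` (class `(2 | ·)`, `γ = (13 2; 32 5)`). [cite: LingOesterle1991, Thm. 1] -/
theorem zsmul_cuspSymbol_gammaFive_not_mem_thirtyTwo (f : CuspForm (Gamma0 32) 2) (hf : f ≠ 0) (n : ℤ)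
    (hn : (n : ZMod 2) ≠ 0) : (n : ℂ) * cuspSymbol f gammaFiveLevel32 ∉ periodLatticeGamma1 f := by
  obtain ⟨φ, hφ⟩ := exists_shimuraHom_thirtyTwo
  refine zsmul_cuspSymbol_not_mem_of_hom φ _ hφ (fun γ₁ ↦ char_apply_gamma1 (by norm_num) charEight (by decide) γ₁) f
    ((finrank_eq_one_iff_of_nonzero' f hf).mp finrank_cuspForm_two_eq_genusX0_thirtyTwo.2.1) gammaFiveLevel32 n ?_
  rw [show (((gammaFiveLevel32 : SL(2, ℤ)) 1 1 : ℤ)) = 5 from rfl, zsmul_eq_mul]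
  rw [show charEight ((5 : ℤ) : ZMod 8) = 1 from by decide, mul_one]
  exact hn

/-- The parabolic `P = (−23 3; −192 25) = k (1 3; 0 1) k⁻¹ ∈ Γ₀(32)`, `k = (1 0; 8 1)`, fixing the cusp `1/8`; `d_P = 25`. [folklore] -/
def parabolicEighth : Gamma0 32 :=
  ⟨⟨!![-23, 3; -192, 25], by rw [Matrix.det_fin_two_of]; norm_num⟩, by
    rw [Gamma0_mem]
    show (((-192 : ℤ) : ZMod 32)) = 0
    decide⟩

/-- `k = (1 0; 8 1)`. [folklore] -/
def kEighth : SL(2, ℤ) := ⟨!![1, 0; 8, 1], by rw [Matrix.det_fin_two_of]; norm_num⟩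

/-- `k⁻¹ = (1 0; −8 1)`. [folklore] -/
def kEighthInv : SL(2, ℤ) := ⟨!![1, 0; -8, 1], by rw [Matrix.det_fin_two_of]; norm_num⟩

/-- `k · k⁻¹ = 1`. [folklore] -/
theorem kEighth_mul_inv : kEighth * kEighthInv = 1 := by
  apply Subtype.ext
  rw [Matrix.SpecialLinearGroup.coe_mul, Matrix.SpecialLinearGroup.coe_one]
  ext i j
  fin_cases i <;> fin_cases j <;> rfl

/-- `{∞, P∞} = 0` in `S₂(Γ₀(32))^∨` (cusp stabiliser). [cite: Manin1972, §1.5] -/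
theorem periodFunctional_parabolicEighth : periodFunctional 32 parabolicEighth = 0 := by
  refine periodFunctional_eq_zero_of_conj_upper parabolicEighth kEighth ?_
  rw [inv_eq_of_mul_eq_one_right kEighth_mul_inv]
  rfl

/-- **`2·{∞, γ∞}_f ∈ Λ₁(f)`** at level `32`: `d_{γ²} = 25 = d_P` and `{∞, P∞} = 0`. [cite: LingOesterle1991, §1] -/
theorem two_mul_cuspSymbol_gammaFive_mem_thirtyTwo (f : CuspForm (Gamma0 32) 2) :
    (2 : ℂ) * cuspSymbol f gammaFiveLevel32 ∈ periodLatticeGamma1 f := by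
  have hpow : cuspSymbol f (gammaFiveLevel32 ^ 2) = (2 : ℂ) * cuspSymbol f gammaFiveLevel32 := by
    rw [cuspSymbol_pow_eq_natCast_mul f gammaFiveLevel32 2]; push_cast; ring
  have hP : cuspSymbol f parabolicEighth = 0 := by
    rw [← periodFunctional_apply, periodFunctional_parabolicEighth, LinearMap.zero_apply]
  have hd : ((((parabolicEighth : SL(2, ℤ)) 1 1 : ℤ) : ZMod 32)) =
      (((gammaFiveLevel32 ^ 2 : Gamma0 32) : SL(2, ℤ)) 1 1 : ℤ) := by
    rw [apply_one_one_pow_eq, show (((gammaFiveLevel32 : SL(2, ℤ)) 1 1 : ℤ)) = 5 from rfl,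
      show (((parabolicEighth : SL(2, ℤ)) 1 1 : ℤ)) = 25 from rfl]
    decide
  have := cuspSymbol_sub_mem_periodLatticeGamma1_of_apply_eq f parabolicEighth (gammaFiveLevel32 ^ 2) hd
  rwa [hP, sub_zero, hpow] at this

/-- **Order exactly `2`** at level `32`: `n·{∞, γ∞}_f ∈ Λ₁(f) ↔ 2 ∣ n` (`f ≠ 0`; E15 row `32a1`: index `2`).
[cite: LingOesterle1991, Thm. 1] -/
theorem zsmul_cuspSymbol_gammaFive_mem_iff_thirtyTwo (f : CuspForm (Gamma0 32) 2) (hf : f ≠ 0) (n : ℤ) :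
    (n : ℂ) * cuspSymbol f gammaFiveLevel32 ∈ periodLatticeGamma1 f ↔ (2 : ℤ) ∣ n := by
  constructor
  · intro h
    by_contra hnd
    exact zsmul_cuspSymbol_gammaFive_not_mem_thirtyTwo f hf n
      (fun h0 ↦ hnd ((ZMod.intCast_zmod_eq_zero_iff_dvd n 2).mp h0)) h
  · rintro ⟨m, rfl⟩
    rw [Int.cast_mul, show ((2 : ℤ) : ℂ) = 2 by norm_num, mul_comm (2 : ℂ) (m : ℂ), mul_assoc, ← zsmul_eq_mul]
    exact (periodLatticeGamma1 f).zsmul_mem (two_mul_cuspSymbol_gammaFive_mem_thirtyTwo f) m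

/-- **`¬ ShimuraIndexPrimeTo 2 f` AT THE ADDITIVE LEVEL `32`** for every non-zero `f ∈ S₂(Γ₀(32))`. [cite: LingOesterle1991, Thm. 1] -/
theorem not_shimuraIndexPrimeTo_two_thirtyTwo (f : CuspForm (Gamma0 32) 2) (hf : f ≠ 0) :
    ¬ ShimuraIndexPrimeTo 2 f := fun h ↦
  (periodLattice_ne_periodLatticeGamma1_thirtyTwo f hf).1
    (h _ (cuspSymbol_mem_periodLattice f gammaFiveLevel32) (by
      rw [show ((2 : ℕ) : ℂ) = 2 by norm_num]
      exact two_mul_cuspSymbol_gammaFive_mem_thirtyTwo f))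

end ThirtyTwo

/-! ## §4. Level `17`: the elliptic element at `i/(4i+1)` — the class of `{∞, γ₃∞}_f` has order exactly `4` -/

section Seventeen

/-- The order-`4` elliptic element `ε = (4 −1; 17 −4) ∈ Γ₀(17)` (`ε² = −1`, fixing `i/(4i+1)`); `d_ε = −4`. [folklore] -/
def ellipticSeventeen : Gamma0 17 :=
  ⟨⟨!![4, -1; 17, -4], by rw [Matrix.det_fin_two_of]; norm_num⟩, by
    rw [Gamma0_mem]
    show (((17 : ℤ) : ZMod 17)) = 0
    decide⟩

/-- `k = (1 0; 4 1)` with `ε k = k S`. [folklore] -/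
def kQuarter : SL(2, ℤ) := ⟨!![1, 0; 4, 1], by rw [Matrix.det_fin_two_of]; norm_num⟩

/-- `ε k = k S`. [folklore] -/
theorem ellipticSeventeen_mul_kQuarter : (ellipticSeventeen : SL(2, ℤ)) * kQuarter = kQuarter * S := by
  apply Subtype.ext
  rw [Matrix.SpecialLinearGroup.coe_mul, Matrix.SpecialLinearGroup.coe_mul]
  ext i j
  fin_cases i <;> fin_cases j <;> rfl

/-- `{∞, ε∞} = 0` in `S₂(Γ₀(17))^∨` (order-`4` elliptic element; landed `periodFunctional_eq_zero_of_conj_S`). [cite: Manin1972, Prop. 1.4] -/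
theorem periodFunctional_ellipticSeventeen : periodFunctional 17 ellipticSeventeen = 0 :=
  periodFunctional_eq_zero_of_conj_S ellipticSeventeen kQuarter ellipticSeventeen_mul_kQuarter

/-- **`4·{∞, γ₃∞}_f ∈ Λ₁(f)`** at level `17`: `d_{γ₃⁴} = 81 ≡ 13 ≡ −4 = d_ε` and `{∞, ε∞} = 0`. [cite: Mazur1977, §II.11] -/
theorem four_mul_cuspSymbol_gammaThree_mem_seventeen (f : CuspForm (Gamma0 17) 2) :
    (4 : ℂ) * cuspSymbol f gammaThree ∈ periodLatticeGamma1 f := by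
  have hpow : cuspSymbol f (gammaThree ^ 4) = (4 : ℂ) * cuspSymbol f gammaThree := by
    rw [cuspSymbol_pow_eq_natCast_mul f gammaThree 4]; push_cast; ring
  have hE : cuspSymbol f ellipticSeventeen = 0 := by
    rw [← periodFunctional_apply, periodFunctional_ellipticSeventeen, LinearMap.zero_apply]
  have hd : ((((ellipticSeventeen : SL(2, ℤ)) 1 1 : ℤ) : ZMod 17)) =
      (((gammaThree ^ 4 : Gamma0 17) : SL(2, ℤ)) 1 1 : ℤ) := by
    rw [apply_one_one_pow_eq, show (((gammaThree : SL(2, ℤ)) 1 1 : ℤ)) = 3 from rfl,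
      show (((ellipticSeventeen : SL(2, ℤ)) 1 1 : ℤ)) = -4 from rfl]
    decide
  have := cuspSymbol_sub_mem_periodLatticeGamma1_of_apply_eq f ellipticSeventeen (gammaThree ^ 4) hd
  rwa [hE, sub_zero, hpow] at this

/-- **THE CLASS OF `{∞, γ₃∞}_f` IN `Λ(f)/Λ₁(f)` HAS ORDER EXACTLY `4 = #Σ(17)`**: `n·{∞, γ₃∞}_f ∈ Λ₁(f) ↔ 4 ∣ n` (`f ≠ 0`;
E15 row `17a1`: index `4`, snf `[4,1]`). [cite: Mazur1977, §II.11] -/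
theorem zsmul_cuspSymbol_gammaThree_mem_iff_seventeen (f : CuspForm (Gamma0 17) 2) (hf : f ≠ 0) (n : ℤ) :
    (n : ℂ) * cuspSymbol f gammaThree ∈ periodLatticeGamma1 f ↔ (4 : ℤ) ∣ n := by
  constructor
  · intro h
    by_contra hnd
    exact zsmul_cuspSymbol_gammaThree_not_mem_seventeen f hf n
      (fun h0 ↦ hnd ((ZMod.intCast_zmod_eq_zero_iff_dvd n 4).mp h0)) h
  · rintro ⟨m, rfl⟩
    rw [Int.cast_mul, show ((4 : ℤ) : ℂ) = 4 by norm_num, mul_comm (4 : ℂ) (m : ℂ), mul_assoc, ← zsmul_eq_mul]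
    exact (periodLatticeGamma1 f).zsmul_mem (four_mul_cuspSymbol_gammaThree_mem_seventeen f) m

/-- **`¬ ShimuraIndexPrimeTo 2 f` AT LEVEL `17`** for every non-zero `f ∈ S₂(Γ₀(17))` (witness `x = 2·{∞, γ₃∞}_f`: `2x ∈ Λ₁(f)`,
`x ∉ Λ₁(f)`). [cite: Mazur1977, §II.11] -/
theorem not_shimuraIndexPrimeTo_two_seventeen (f : CuspForm (Gamma0 17) 2) (hf : f ≠ 0) :
    ¬ ShimuraIndexPrimeTo 2 f := fun h ↦
  (two_mul_cuspSymbol_gammaThree_not_mem_seventeen f hf).1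
    (h _ (by
        rw [show (2 : ℂ) * cuspSymbol f gammaThree = (2 : ℤ) • cuspSymbol f gammaThree by rw [zsmul_eq_mul]; norm_num]
        exact (periodLattice f).zsmul_mem (cuspSymbol_mem_periodLattice f gammaThree) 2) (by
      rw [show ((2 : ℕ) : ℂ) * ((2 : ℂ) * cuspSymbol f gammaThree) = (4 : ℂ) * cuspSymbol f gammaThree by ring]
      exact four_mul_cuspSymbol_gammaThree_mem_seventeen f))

end Seventeen

end Summit.BirchSwinnertonDyer.BirchSwinnertonDyer.Theorems.ManinLocalTwoThree.ShimuraTwo
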